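import Summits.AtomisticToContinuum.Crystallization.Theses.GappedShellCensus
import Literature.Geometry.DiscreteGeometry.DihedralAngleFraction

/-!
# Crux `GappedShellCensus.TornFree` (stmt-AtomisticToContinuum-18069), line `Sketch` —
# stub `stub_tfPerpLower`

**Commons are off-axis.**  For a bond `(y, v)` at scale `a` and a common neighbour `w` of its
two ends (the three lengths `|yv|`, `|yw|`, `|vw|` in `[0.98a, 1.02a]`), the component
`perpTo (v − y) (w − y)` of `w − y` orthogonal to the bond direction `v − y` has norm `≥ 3a/4`
(the true minimum over the box is `≈ 0.8368a`; the lead only needs `perpTo (v − y) (w − y) ≠ 0`).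

## Proof

Put `b = v − y`, `x = w − y`, `ℓ = ‖b‖ = |yv|`, `r = ‖x‖ = |yw|`, `s = ‖b − x‖ = |vw|`.  Since
`ℓ ≥ 0.98a > 0`, `b ≠ 0` and `inner_perpTo_self` gives `‖perpTo b x‖² = r² − ⟪b, x⟫² / ℓ²`,
while polarisation gives `⟪b, x⟫ = (ℓ² + r² − s²) / 2`.  Hence
`4 ℓ² ‖perpTo b x‖² = 4 ℓ² r² − (ℓ² + r² − s²)² = (s² − (ℓ − r)²) ((ℓ + r)² − s²)`,
and on the box `s² − (ℓ − r)² ≥ (0.9604 − 0.0016) a² = 0.9588 a²` and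
`(ℓ + r)² − s² ≥ (3.8416 − 1.0404) a² = 2.8012 a²`, so
`4 ℓ² ‖perpTo b x‖² ≥ 2.6858 a⁴ ≥ (9/4) · 1.0404 · a⁴ ≥ (9/4) a² ℓ² = 4 ℓ² (3a/4)²`.
Dividing by `ℓ² > 0` and taking square roots gives the claim.  Pure real polynomial arithmetic
on top of the `perpTo` API of `Literature/Geometry/DiscreteGeometry/DihedralAngleFraction.lean`.
-/

noncomputable section

namespace Summit.AtomisticToContinuum.Crystallization.Theorems

open scoped RealInnerProductSpace
open Literature.Geometry.DiscreteGeometry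

/-! ### Helpers -/

/-- The polynomial heart: for `ℓ, r, s ∈ [0.98a, 1.02a]`,
`(3a/4)² ℓ² ≤ r² ℓ² − ((ℓ² + r² − s²)/2)²`, via the factorisation
`4 r² ℓ² − (ℓ² + r² − s²)² = (s² − (ℓ − r)²) ((ℓ + r)² − s²)`. -/
private theorem tfPerpLower_poly {a l r s : ℝ} (ha : 0 < a)
    (hl1 : a * (1 - 1 / 50) ≤ l) (hl2 : l ≤ a * (1 + 1 / 50))
    (hr1 : a * (1 - 1 / 50) ≤ r) (hr2 : r ≤ a * (1 + 1 / 50))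
    (hs1 : a * (1 - 1 / 50) ≤ s) (hs2 : s ≤ a * (1 + 1 / 50)) :
    (a * (3 / 4)) ^ 2 * l ^ 2 ≤ r ^ 2 * l ^ 2 - ((l ^ 2 + r ^ 2 - s ^ 2) / 2) ^ 2 := by
  have hs0 : 0 ≤ s := by linarith
  have hl0 : 0 ≤ l := by linarith
  -- the two factors of `4 r² ℓ² − (ℓ² + r² − s²)²`
  have h1 : 9588 / 10000 * a ^ 2 ≤ s ^ 2 - (l - r) ^ 2 := by
    nlinarith [mul_nonneg (sub_nonneg.2 hs1) (by linarith : (0 : ℝ) ≤ s + a * (1 - 1 / 50)),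
      mul_nonneg (by linarith : (0 : ℝ) ≤ a * (1 / 25) - (l - r))
        (by linarith : (0 : ℝ) ≤ a * (1 / 25) + (l - r))]
  have h2 : 28012 / 10000 * a ^ 2 ≤ (l + r) ^ 2 - s ^ 2 := by
    nlinarith [mul_nonneg (by linarith : (0 : ℝ) ≤ l + r - a * (49 / 25))
        (by linarith : (0 : ℝ) ≤ l + r + a * (49 / 25)),
      mul_nonneg (sub_nonneg.2 hs2) (by linarith : (0 : ℝ) ≤ a * (1 + 1 / 50) + s)]
  have h3 : 9588 / 10000 * a ^ 2 * (28012 / 10000 * a ^ 2) ≤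
      (s ^ 2 - (l - r) ^ 2) * ((l + r) ^ 2 - s ^ 2) :=
    mul_le_mul h1 h2 (by positivity) ((by positivity : (0 : ℝ) ≤ 9588 / 10000 * a ^ 2).trans h1)
  -- `ℓ² ≤ 1.0404 a²`, multiplied by `a²`
  have h4 : l ^ 2 ≤ (a * (1 + 1 / 50)) ^ 2 := pow_le_pow_left₀ hl0 hl2 2
  have h5 : a ^ 2 * l ^ 2 ≤ a ^ 2 * (a * (1 + 1 / 50)) ^ 2 :=
    mul_le_mul_of_nonneg_left h4 (sq_nonneg a)
  have hid : r ^ 2 * l ^ 2 - ((l ^ 2 + r ^ 2 - s ^ 2) / 2) ^ 2 =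
      1 / 4 * ((s ^ 2 - (l - r) ^ 2) * ((l + r) ^ 2 - s ^ 2)) := by ring
  rw [hid]
  nlinarith [h3, h5, sq_nonneg (a ^ 2)]

/-- Vector form at scale `a`: for `b, x ∈ ℝ³` with `‖b‖, ‖x‖, ‖b − x‖ ∈ [0.98a, 1.02a]`,
`3a/4 ≤ ‖perpTo b x‖`. -/
private theorem tfPerpLower_vec {a : ℝ} (ha : 0 < a) (b x : EuclideanSpace ℝ (Fin 3))
    (hl1 : a * (1 - 1 / 50) ≤ ‖b‖) (hl2 : ‖b‖ ≤ a * (1 + 1 / 50))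
    (hr1 : a * (1 - 1 / 50) ≤ ‖x‖) (hr2 : ‖x‖ ≤ a * (1 + 1 / 50))
    (hs1 : a * (1 - 1 / 50) ≤ ‖b - x‖) (hs2 : ‖b - x‖ ≤ a * (1 + 1 / 50)) :
    a * (3 / 4) ≤ ‖perpTo b x‖ := by
  have hlpos : 0 < ‖b‖ := lt_of_lt_of_le (mul_pos ha (by norm_num)) hl1
  have hb0 : b ≠ 0 := norm_pos_iff.1 hlpos
  have hbb : ⟪b, b⟫ = ‖b‖ ^ 2 := real_inner_self_eq_norm_sq b
  -- polarisation
  have hP : ⟪b, x⟫ = (‖b‖ ^ 2 + ‖x‖ ^ 2 - ‖b - x‖ ^ 2) / 2 := by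
    rw [norm_sub_sq_real]; ring
  -- `‖perpTo b x‖² = ‖x‖² − ⟪b, x⟫² / ‖b‖²`
  have hpp : ‖perpTo b x‖ ^ 2 = ‖x‖ ^ 2 - ⟪b, x⟫ ^ 2 / ‖b‖ ^ 2 := by
    rw [← real_inner_self_eq_norm_sq (perpTo b x), inner_perpTo_self hb0,
      real_inner_self_eq_norm_sq x, hbb]
  have hl2pos : 0 < ‖b‖ ^ 2 := by positivity
  have key : (a * (3 / 4)) ^ 2 ≤ ‖perpTo b x‖ ^ 2 := by
    refine le_of_mul_le_mul_right ?_ hl2pos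
    rw [hpp, sub_mul, div_mul_cancel₀ _ hl2pos.ne', hP]
    exact tfPerpLower_poly ha hl1 hl2 hr1 hr2 hs1 hs2
  exact (pow_le_pow_iff_left₀ (by positivity) (norm_nonneg _) two_ne_zero).1 key

/-! ### The stub -/

/-- **Stub (commons are off-axis).** A common neighbour `w` of a bond `(y, v)` (all three lengths
`|yv|`, `|yw|`, `|vw|` in `[0.98a, 1.02a]`) is at distance `≥ 3a/4` from the bond axis:
`‖perpTo (v − y) (w − y)‖ ≥ 3a/4` (the true minimum is `≈ 0.8368a`). [folklore] -/
theorem stub_tfPerpLower :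
    ∀ (a : ℝ), 0 < a → ∀ y v w : EuclideanSpace ℝ (Fin 3),
      a * (1 - 1 / 50) ≤ dist y v → dist y v ≤ a * (1 + 1 / 50) →
      a * (1 - 1 / 50) ≤ dist y w → dist y w ≤ a * (1 + 1 / 50) →
      a * (1 - 1 / 50) ≤ dist v w → dist v w ≤ a * (1 + 1 / 50) →
      a * (3 / 4) ≤ ‖perpTo (v - y) (w - y)‖ := by
  intro a ha y v w hyv1 hyv2 hyw1 hyw2 hvw1 hvw2
  rw [dist_eq_norm_sub'] at hyv1 hyv2 hyw1 hyw2
  rw [dist_eq_norm, ← sub_sub_sub_cancel_right v w y] at hvw1 hvw2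
  exact tfPerpLower_vec ha (v - y) (w - y) hyv1 hyv2 hyw1 hyw2 hvw1 hvw2

end Summit.AtomisticToContinuum.Crystallization.Theorems

end
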